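import Summits.CriticalPhenomena.PercolationContinuityZ3.Theorems.PercNearOneGluingNoHeavyLowerTailChampionStability
import Summits.CriticalPhenomena.PercolationContinuityZ3.Theorems.PercNearOneGluingAdditiveGluingEdgeAffine
import Literature.Probability.LatticeModels.ProdBernoulliIndependence
import HarnessLib

/-!
# `NoHeavyLowerTail` (stmt-CriticalPhenomena-4575) — OFF-OBSERVER TRANSPORT: a reachability functional of `ω ∖ o` under `μ_u` is the
# same functional of `ω` under `u` with the pairs at `o` switched off

Support file (prover `prim-hp-3`, hull-port line; `--supports stmt-CriticalPhenomena-4575`).  No definitions, no named facts, no sorries.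
Bookkeeping lemma (ii-c) of the Lean roadmap for the overtaking bound (run/shared/lean/prim/prim-hp-3/PROOF-OVERTAKING-BOUND.md §5): the star
expansions (`Hyperedge.reachFunctional_star_expansion`) produce inner events `Φ(Reach_{ω ∩ {e | o ∉ e}})` under the ORIGINAL measure `μ_u`; to
apply the glue bridge and the cell inequalities they must be read as events of `ω` itself under the weight `u ∖ o := fun e => if o ∈ e then 0 else u e`.

**Theorem (`Hyperedge.real_reachFunctional_offObserver`).**  For every weight `u`, vertex `o` and functional `Ψ` of the reachability relation,
`μ_u{ω | Ψ(Reach_{ω ∖ o})} = μ_{u∖o}{ω | Ψ(Reach_ω)}`.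
Proof: the event on the left does not see the pairs at `o`, so switching them off one at a time does not change its probability
(`real_update_affine` + `tieLiftOne_real_one_eq`, `Hyperedge.real_update_zero_of_insert_invariant`); under `u ∖ o` no pair at `o` is open almost
surely (`prodBernoulli_real_setOf_mem`), so `ω ∖ o = ω` off a null set.
-/

noncomputable section

namespace Summit.CriticalPhenomena.PercolationContinuityZ3.Theorems

open MeasureTheory Set Literature.Probability.LatticeModels Literature.Probability.Percolation
open scoped Classical BigOperators

variable {n : ℕ}

namespace Hyperedge

/-- An event invariant under opening the pair `e` has the same probability under `w` and `w[e ↦ 0]`. [folklore] -/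
theorem real_update_zero_of_insert_invariant (w : Sym2 (Fin n) → unitInterval) (e : Sym2 (Fin n))
    (E : Set (BondConfig (Fin n))) (hE : (fun ω : BondConfig (Fin n) => insert e ω) ⁻¹' E = E) :
    (prodBernoulli (Function.update w e 0)).real E = (prodBernoulli w).real E := by
  have h10 : (prodBernoulli (Function.update w e 1)).real E = (prodBernoulli (Function.update w e 0)).real E := by
    rw [tieLiftOne_real_one_eq, hE]
  have hwe : ((w e : ℝ)) ∈ Set.Icc (0 : ℝ) 1 := (w e).2
  have haff := real_update_affine w e E hwe
  have hproj : Set.projIcc (0 : ℝ) 1 zero_le_one ((w e : ℝ)) = w e := Set.projIcc_val zero_le_one (w e)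
  rw [hproj, Function.update_eq_self, h10, sub_self, mul_zero, add_zero] at haff
  exact haff.symm

/-- Opening a pair AT `o` does not change `ω ∖ o`. [folklore] -/
theorem insert_inter_avoid_eq (ω : BondConfig (Fin n)) {o : Fin n} {e : Sym2 (Fin n)} (he : o ∈ e) :
    insert e ω ∩ {f : Sym2 (Fin n) | o ∉ f} = ω ∩ {f | o ∉ f} := by
  ext f
  simp only [mem_inter_iff, mem_insert_iff, mem_setOf_eq]
  constructor
  · rintro ⟨hf | hf, hof⟩
    · exact absurd (hf ▸ he) hof
    · exact ⟨hf, hof⟩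
  · rintro ⟨hf, hof⟩
    exact ⟨Or.inr hf, hof⟩

/-- Switching off a list of pairs at `o`, as an iterated update, evaluated pointwise. [folklore] -/
theorem foldr_update_zero_apply (u : Sym2 (Fin n) → unitInterval) (o : Fin n) :
    ∀ (L : List (Fin n)) (f : Sym2 (Fin n)),
      (L.foldr (fun y w' => Function.update w' s(o, y) 0) u) f = if ∃ y ∈ L, f = s(o, y) then 0 else u f
  | [], f => by simp
  | y :: L, f => by
    rw [List.foldr_cons]
    by_cases hf : f = s(o, y)
    · subst hf
      rw [Function.update_self, if_pos ⟨y, by simp, rfl⟩]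
    · rw [Function.update_of_ne hf, foldr_update_zero_apply u o L f]
      by_cases h : ∃ y' ∈ L, f = s(o, y')
      · rw [if_pos h, if_pos (by obtain ⟨y', hy', hfy'⟩ := h; exact ⟨y', List.mem_cons_of_mem y hy', hfy'⟩)]
      · rw [if_neg h, if_neg (by
          rintro ⟨y', hy', hfy'⟩
          rcases List.mem_cons.1 hy' with rfl | hy'
          · exact hf hfy'
          · exact h ⟨y', hy', hfy'⟩)]

/-- Switching off every pair at `o` one at a time gives `u ∖ o`. [folklore] -/
theorem foldr_update_zero_eq_off (u : Sym2 (Fin n) → unitInterval) (o : Fin n) :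
    (List.finRange n).foldr (fun y w' => Function.update w' s(o, y) 0) u =
      fun e => if o ∈ e then 0 else u e := by
  funext f
  rw [foldr_update_zero_apply]
  have hiff : (∃ y ∈ List.finRange n, f = s(o, y)) ↔ o ∈ f := by
    constructor
    · rintro ⟨y, -, rfl⟩
      exact Sym2.mem_mk_left o y
    · intro h
      obtain ⟨y, hy⟩ := Sym2.mem_iff_exists.1 h
      exact ⟨y, List.mem_finRange y, hy⟩
  simp only [hiff]

/-- **Off-observer transport.**  `μ_u{Ψ(Reach_{ω∖o})} = μ_{u∖o}{Ψ(Reach_ω)}` with `u ∖ o = fun e => if o ∈ e then 0 else u e`. [folklore] -/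
theorem real_reachFunctional_offObserver (u : Sym2 (Fin n) → unitInterval) (o : Fin n)
    (Ψ : (Fin n → Fin n → Prop) → Prop) :
    (prodBernoulli u).real {ω : BondConfig (Fin n) | Ψ fun a b => (openGraph (ω ∩ {e | o ∉ e})).Reachable a b} =
      (prodBernoulli (fun e => if o ∈ e then (0 : unitInterval) else u e)).real
        {ω : BondConfig (Fin n) | Ψ fun a b => (openGraph ω).Reachable a b} := by
  set E := {ω : BondConfig (Fin n) | Ψ fun a b => (openGraph (ω ∩ {e | o ∉ e})).Reachable a b} with hE
  set E' := {ω : BondConfig (Fin n) | Ψ fun a b => (openGraph ω).Reachable a b} with hE'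
  -- (1) `E` is invariant under opening any pair at `o`
  have hinv : ∀ y : Fin n, (fun ω : BondConfig (Fin n) => insert s(o, y) ω) ⁻¹' E = E := by
    intro y
    ext ω
    simp only [mem_preimage, hE, mem_setOf_eq]
    rw [insert_inter_avoid_eq ω (Sym2.mem_mk_left o y)]
  -- (2) switching off the pairs at `o` one at a time does not change `μ(E)`
  have hfold : ∀ L : List (Fin n),
      (prodBernoulli (L.foldr (fun y w' => Function.update w' s(o, y) 0) u)).real E = (prodBernoulli u).real E := by
    intro L
    induction L with
    | nil => simp
    | cons y L ih =>
      rw [List.foldr_cons, real_update_zero_of_insert_invariant _ _ E (hinv y), ih]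
  have h2 : (prodBernoulli u).real E = (prodBernoulli (fun e => if o ∈ e then (0 : unitInterval) else u e)).real E := by
    rw [← foldr_update_zero_eq_off u o, hfold]
  rw [h2]
  -- (3) under `u ∖ o` no pair at `o` is open almost surely, so `E` and `E'` agree off a null set
  set K : Sym2 (Fin n) → unitInterval := fun e => if o ∈ e then 0 else u e with hK
  set N : Set (BondConfig (Fin n)) := ⋃ y ∈ (Finset.univ : Finset (Fin n)), {ω : BondConfig (Fin n) | s(o, y) ∈ ω} with hN
  have hN0 : (prodBernoulli K).real N = 0 := by
    refine le_antisymm (le_trans (measureReal_biUnion_finset_le _ _) ?_) measureReal_nonneg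
    refine le_of_eq (Finset.sum_eq_zero fun y _ => ?_)
    rw [prodBernoulli_real_setOf_mem]
    simp [hK]
  have hagree : ∀ ω : BondConfig (Fin n), ω ∉ N → (ω ∈ E ↔ ω ∈ E') := by
    intro ω hω
    have hωo : ω ∩ {e | o ∉ e} = ω := by
      ext f
      simp only [mem_inter_iff, mem_setOf_eq, and_iff_left_iff_imp]
      intro hf hof
      obtain ⟨y, hy⟩ := Sym2.mem_iff_exists.1 hof
      exact hω (Set.mem_biUnion (Finset.mem_univ y) (by rw [mem_setOf_eq, ← hy]; exact hf))
    simp only [hE, hE', mem_setOf_eq, hωo]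
  have hle1 : (prodBernoulli K).real E ≤ (prodBernoulli K).real E' := by
    calc (prodBernoulli K).real E ≤ (prodBernoulli K).real (E' ∪ N) :=
          measureReal_mono (fun ω hω => by
            by_cases hωN : ω ∈ N
            · exact Or.inr hωN
            · exact Or.inl ((hagree ω hωN).1 hω)) (measure_ne_top _ _)
      _ ≤ (prodBernoulli K).real E' + (prodBernoulli K).real N := measureReal_union_le _ _
      _ = (prodBernoulli K).real E' := by rw [hN0, add_zero]
  have hle2 : (prodBernoulli K).real E' ≤ (prodBernoulli K).real E := by
    calc (prodBernoulli K).real E' ≤ (prodBernoulli K).real (E ∪ N) :=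
          measureReal_mono (fun ω hω => by
            by_cases hωN : ω ∈ N
            · exact Or.inr hωN
            · exact Or.inl ((hagree ω hωN).2 hω)) (measure_ne_top _ _)
      _ ≤ (prodBernoulli K).real E + (prodBernoulli K).real N := measureReal_union_le _ _
      _ = (prodBernoulli K).real E := by rw [hN0, add_zero]
  exact le_antisymm hle1 hle2

end Hyperedge

end Summit.CriticalPhenomena.PercolationContinuityZ3.Theorems
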